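import Literature.NumberTheory.Sieve.PrimesInAPGallagherExceptionalShape
import Literature.NumberTheory.Sieve.MontgomeryVaughan1975Zeros
import Literature.NumberTheory.LFunctions.PrimitiveQuadraticCharacterKronecker
import Mathlib.NumberTheory.LSeries.Nonvanishing
import Mathlib.Analysis.SpecialFunctions.Pow.Asymptotics
import HarnessLib

/-!
# Linnik-type prime supply at 2-power moduli — UNCONDITIONAL

Topic `Literature/NumberTheory/Sieve`. THEOREMS only.

Linnik's theorem (Linnik 1944; Heath-Brown 1992; Xylouris 2011: the least prime `p ≡ a (mod m)` is `≪ m^L`)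
needs, for a general modulus, the Deuring–Heilbronn phenomenon to neutralise a possible exceptional
(Siegel) zero of a real character of conductor dividing `m`.  For the moduli `2^s` no such zero exists for
large `s`: by Page's theorem an exceptional zero belongs to a primitive QUADRATIC character (tree:
`MontgomeryVaughan1975.exists_exceptionalZero_unique`), a primitive quadratic character of conductor `2^k`
has `k ≤ 3` (tree: `PrimitiveQuadratic.level_two_pow_le_three`; the conductors `4`, `8` of `χ₋₄`, `χ₈`,
`χ₋₈` — Montgomery–Vaughan Thm. 9.13; Green 2012 §4), and the finitely many non-principal characters mod
`2`, `4`, `8` have `L(β, χ) ≠ 0` on a fixed neighbourhood of `β = 1` (`L(1, χ) ≠ 0`, Mathlib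
`DirichletCharacter.LFunction_apply_one_ne_zero`, and continuity).  Feeding this into the tree's
UNCONDITIONAL Gallagher prime number theorem off one exceptional modulus, in the shape-exposing form
`PrimesInAPGallagher.primesInAP_lowerBound_shape`, gives primes `p ≡ 1 (mod 2^s)` with `p ≤ 2^{As}`, and
— dodging an odd exceptional conductor by keeping two partners — primes `ℓ ≡ 1 (mod 2^s q)` with `q ≡ 1
(mod 2^s)` prime and `ℓ ≤ 2^{As}`:

* `exists_eta_LFunction_ne_zero` — for a fixed modulus `n`, some `η > 0` with `L(β, χ) ≠ 0` for all
  `χ ≠ 1` mod `n` and `|β − 1| ≤ η`;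
* `exists_goodModulus_not_dvd_two_pow` — Gallagher's lower bound for `#{p ≤ N : p ≡ 1 (mod d)}`,
  `d ≤ N^δ`, `b ∤ d`, where now `b` divides NO `2^s ≤ N^δ`;
* `exists_two_primes_one_mod_two_pow` — two distinct primes `≡ 1 (mod 2^s)` below `2^{As}`;
* `exists_primes_two_pow_mul_dvd_sub_one` — the two-prime supply: for `s ≥ s₁`, primes `q`, `ℓ` with
  `2^s ∣ q − 1`, `2^s q ∣ ℓ − 1`, `ℓ ≤ 2^{As}` (the prime supply of the negation line `forced-pair-dlog`
  of crux `EisensteinQuarantine`, route `ABC/DefiniteXi`).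

## References

* P. X. Gallagher, Invent. Math. 11 (1970) 329–339, Theorem 7 [Gallagher1970].
* H. L. Montgomery, R. C. Vaughan, *Multiplicative Number Theory I*, CUP 2007, Cor. 11.10 (Page), Thm. 9.13
  [MontgomeryVaughan2007].
* B. Green, Combin. Probab. Comput. 21 (2012), §4 ("for moduli `2^t` there is no exceptional zero")
  [Green2012].
* Yu. V. Linnik, Rec. Math. [Mat. Sbornik] N.S. 15(57) (1944), 139–178 and 347–368.
-/

noncomputable section

open Finset Real Filter

namespace Literature.NumberTheory.Sieve

namespace PrimesInAPGallagher

open MontgomeryVaughan1975 Literature.NumberTheory.LFunctions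

/-! ### No zero of `L(s, χ)` near `s = 1`, uniformly over the characters of a fixed modulus -/

/-- **`L(β, χ) ≠ 0` near `β = 1`, uniformly in the non-principal `χ` of a FIXED modulus `n`.**  For each
`χ ≠ 1`, `L(1, χ) ≠ 0` (Dirichlet; Mathlib `DirichletCharacter.LFunction_apply_one_ne_zero`) and
`s ↦ L(s, χ)` is continuous (entire), so `L(β, χ) ≠ 0` for `|β − 1| < ε_χ`; the characters mod `n` are
finitely many. [folklore] -/
theorem exists_eta_LFunction_ne_zero (n : ℕ) [NeZero n] :
    ∃ η : ℝ, 0 < η ∧ ∀ χ : DirichletCharacter ℂ n, χ ≠ 1 →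
      ∀ β : ℝ, 1 - η ≤ β → β ≤ 1 + η → χ.LFunction (β : ℂ) ≠ 0 := by
  classical
  have key : ∀ χ : DirichletCharacter ℂ n, ∃ η : ℝ, 0 < η ∧
      (χ ≠ 1 → ∀ β : ℝ, 1 - η ≤ β → β ≤ 1 + η → χ.LFunction (β : ℂ) ≠ 0) := by
    intro χ
    by_cases hχ : χ = 1
    · exact ⟨1, one_pos, fun h => absurd hχ h⟩
    · have hcont : ContinuousAt (fun x : ℝ => χ.LFunction (x : ℂ)) 1 :=
        ((DirichletCharacter.differentiable_LFunction hχ).continuous.comp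
          Complex.continuous_ofReal).continuousAt
      have h1 : (fun x : ℝ => χ.LFunction (x : ℂ)) 1 ≠ 0 := by
        simp only [Complex.ofReal_one]
        exact DirichletCharacter.LFunction_apply_one_ne_zero hχ
      obtain ⟨ε, hε, hball⟩ := Metric.eventually_nhds_iff.mp (hcont.eventually_ne h1)
      refine ⟨ε / 2, by positivity, fun _ β hlo hhi => hball ?_⟩
      rw [Real.dist_eq, abs_lt]
      constructor <;> linarith
  choose ηf hηf0 hηf using key
  haveI : Fintype (DirichletCharacter ℂ n) := Fintype.ofFinite _
  refine ⟨Finset.univ.inf' ⟨1, Finset.mem_univ _⟩ ηf, (Finset.lt_inf'_iff _).mpr fun χ _ => hηf0 χ,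
    fun χ hχ β hlo hhi => ?_⟩
  have hle : Finset.univ.inf' ⟨1, Finset.mem_univ _⟩ ηf ≤ ηf χ := Finset.inf'_le _ (Finset.mem_univ χ)
  exact hηf χ hχ β (by linarith) (by linarith)

/-- **The same uniformly over the moduli `2^i`, `i ≤ 3`** (the only 2-power conductors of primitive
quadratic characters; four applications of `exists_eta_LFunction_ne_zero`). [folklore] -/
theorem exists_eta_LFunction_ne_zero_two_pow :
    ∃ η : ℝ, 0 < η ∧ ∀ i : ℕ, i ≤ 3 → ∀ χ : DirichletCharacter ℂ (2 ^ i), χ ≠ 1 →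
      ∀ β : ℝ, 1 - η ≤ β → β ≤ 1 + η → χ.LFunction (β : ℂ) ≠ 0 := by
  haveI h2i : ∀ i : ℕ, NeZero (2 ^ i) := fun i => ⟨pow_ne_zero _ two_ne_zero⟩
  obtain ⟨η₀, h₀, H₀⟩ := exists_eta_LFunction_ne_zero (2 ^ 0)
  obtain ⟨η₁, h₁, H₁⟩ := exists_eta_LFunction_ne_zero (2 ^ 1)
  obtain ⟨η₂, h₂, H₂⟩ := exists_eta_LFunction_ne_zero (2 ^ 2)
  obtain ⟨η₃, h₃, H₃⟩ := exists_eta_LFunction_ne_zero (2 ^ 3)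
  refine ⟨min (min η₀ η₁) (min η₂ η₃), lt_min (lt_min h₀ h₁) (lt_min h₂ h₃), fun i hi χ hχ β hlo hhi => ?_⟩
  have hm₀ : min (min η₀ η₁) (min η₂ η₃) ≤ η₀ := (min_le_left _ _).trans (min_le_left _ _)
  have hm₁ : min (min η₀ η₁) (min η₂ η₃) ≤ η₁ := (min_le_left _ _).trans (min_le_right _ _)
  have hm₂ : min (min η₀ η₁) (min η₂ η₃) ≤ η₂ := (min_le_right _ _).trans (min_le_left _ _)
  have hm₃ : min (min η₀ η₁) (min η₂ η₃) ≤ η₃ := (min_le_right _ _).trans (min_le_right _ _)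
  interval_cases i
  · exact H₀ χ hχ β (by linarith) (by linarith)
  · exact H₁ χ hχ β (by linarith) (by linarith)
  · exact H₂ χ hχ β (by linarith) (by linarith)
  · exact H₃ χ hχ β (by linarith) (by linarith)

/-! ### The exceptional modulus divides no `2`-power in range -/

/-- **Gallagher's lower bound with an exceptional modulus dividing no `2`-power in range — UNCONDITIONAL.**
There are `δ > 0` and `N₁` such that for every `N ≥ N₁` there is `b ≥ 2` with
`#{p ≤ N prime : p ≡ 1 (mod d)} ≥ (1/2) N/(φ(d) log N)` for all `1 ≤ d ≤ N^δ` with `b ∤ d`, and `b ∤ 2^s`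
whenever `2^s ≤ N^δ`.  Proof: by `primesInAP_lowerBound_shape`, `b > N^{δ₀}` (then `b ∤ 2^s ≤ N^δ`) or
`b` is the modulus of an exceptional datum `(b, χ̃, β̃)` at level `c₃`, `P = N^{δ₀}`; if `b ∣ 2^s` then
`b = 2^i ≤ N^δ`, and with `δ = min(δ₀, c_P δ₀/(2c₃))` Page's theorem at height `T = N^δ`
(`1 − c_P/log T < 1 − c₃/log P ≤ β̃`) makes `χ̃` quadratic, so `i ≤ 3` (`level_two_pow_le_three`), and
`L(β̃, χ̃) = 0` with `β̃ ≥ 1 − c₃/(δ₀ log N) ≥ 1 − η` contradicts `exists_eta_LFunction_ne_zero_two_pow`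
for `N` large. [cite: Gallagher1970, Theorem 7] [cite: MontgomeryVaughan2007, Cor. 11.10 and Thm. 9.13] -/
theorem exists_goodModulus_not_dvd_two_pow :
    ∃ δ : ℝ, 0 < δ ∧ ∃ N₁ : ℕ, ∀ N : ℕ, N₁ ≤ N → ∃ b : ℕ, 2 ≤ b ∧
      (∀ s : ℕ, ((2 ^ s : ℕ) : ℝ) ≤ (N : ℝ) ^ δ → ¬ b ∣ 2 ^ s) ∧
      ∀ d : ℕ, 1 ≤ d → (d : ℝ) ≤ (N : ℝ) ^ δ → ¬ b ∣ d →
        (1 / 2 : ℝ) * N / (Nat.totient d * Real.log N) ≤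
          (((Finset.Iic N).filter (fun p => p.Prime ∧ p ≡ 1 [MOD d])).card : ℝ) := by
  classical
  obtain ⟨c₃, hc₃, δ₀, hδ₀, N₀, hN₀⟩ := primesInAP_lowerBound_shape
  obtain ⟨cP, hcP, hPage⟩ := exists_exceptionalZero_unique
  obtain ⟨η, hη, hηL⟩ := exists_eta_LFunction_ne_zero_two_pow
  set δ : ℝ := min δ₀ (cP * δ₀ / (2 * c₃)) with hδdef
  have hδ0 : 0 < δ := lt_min hδ₀ (by positivity)
  have hδδ₀ : δ ≤ δ₀ := min_le_left _ _
  have hδc : c₃ * δ < cP * δ₀ := by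
    have : δ ≤ cP * δ₀ / (2 * c₃) := min_le_right _ _
    have h2 : c₃ * δ ≤ cP * δ₀ / 2 := by
      calc c₃ * δ ≤ c₃ * (cP * δ₀ / (2 * c₃)) := mul_le_mul_of_nonneg_left this hc₃.le
        _ = cP * δ₀ / 2 := by field_simp
    have h3 : 0 < cP * δ₀ := by positivity
    linarith
  -- eventual conditions on `N`: `N ≥ N₀`, `N ≥ 2`, `4 ≤ N^δ`, `c₃/(δ₀ η) ≤ log N`
  have hrpow : Tendsto (fun N : ℕ => ((N : ℝ)) ^ δ) atTop atTop :=
    (tendsto_rpow_atTop hδ0).comp tendsto_natCast_atTop_atTop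
  have hlogN : Tendsto (fun N : ℕ => Real.log N) atTop atTop :=
    Real.tendsto_log_atTop.comp tendsto_natCast_atTop_atTop
  have hev : ∀ᶠ N : ℕ in atTop, N₀ ≤ N ∧ 2 ≤ N ∧ (4 : ℝ) ≤ (N : ℝ) ^ δ ∧
      c₃ / (δ₀ * η) ≤ Real.log N :=
    (eventually_ge_atTop N₀).and ((eventually_ge_atTop 2).and
      ((hrpow.eventually (eventually_ge_atTop _)).and (hlogN.eventually (eventually_ge_atTop _))))
  obtain ⟨N₁, hN₁⟩ := eventually_atTop.mp hev
  refine ⟨δ, hδ0, N₁, fun N hN => ?_⟩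
  obtain ⟨hNN₀, hN2, hT4, hlogη⟩ := hN₁ N hN
  obtain ⟨b, hb2, hshape, hcount⟩ := hN₀ N hNN₀
  have hN0 : (0 : ℝ) < N := by exact_mod_cast (show 0 < N by omega)
  have hN1 : (1 : ℝ) < N := by exact_mod_cast (show 1 < N by omega)
  have hL0 : 0 < Real.log N := Real.log_pos hN1
  have hmono : (N : ℝ) ^ δ ≤ (N : ℝ) ^ δ₀ := Real.rpow_le_rpow_of_exponent_le hN1.le hδδ₀
  refine ⟨b, hb2, fun s hs hbdvd => ?_,
    fun d hd1 hdδ hbd => hcount d hd1 (hdδ.trans hmono) hbd⟩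
  -- `b = 2^i ≤ 2^s ≤ N^δ`
  obtain ⟨i, his, rfl⟩ := (Nat.dvd_prime_pow Nat.prime_two).mp hbdvd
  have hbT : ((2 ^ i : ℕ) : ℝ) ≤ (N : ℝ) ^ δ :=
    le_trans (by exact_mod_cast Nat.pow_le_pow_right two_pos his) hs
  rcases hshape with hlt | ⟨_, χe, β, hexc⟩
  · -- `N^δ₀ < b ≤ N^δ ≤ N^δ₀`: impossible
    linarith
  · obtain ⟨hprim, hne, -, hβlo, hβ1, hzero⟩ := hexc
    -- Page's theorem at height `T = N^δ`: the exceptional character is quadratic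
    have hlogT : Real.log ((N : ℝ) ^ δ) = δ * Real.log N := Real.log_rpow hN0 δ
    have hlogP : Real.log ((N : ℝ) ^ δ₀) = δ₀ * Real.log N := Real.log_rpow hN0 δ₀
    have hthr : 1 - cP / Real.log ((N : ℝ) ^ δ) < β := by
      rw [hlogP] at hβlo
      rw [hlogT]
      have hlt' : c₃ / (δ₀ * Real.log N) < cP / (δ * Real.log N) := by
        rw [div_lt_div_iff₀ (by positivity) (by positivity)]
        have := mul_lt_mul_of_pos_right hδc hL0
        nlinarith
      linarith
    have hquad : χe ^ 2 = 1 :=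
      ((hPage ((N : ℝ) ^ δ) hT4).1 (2 ^ i) χe hne hbT (β : ℂ) (by exact_mod_cast hzero)
        (by rw [Complex.ofReal_im, abs_zero]; linarith) (by rwa [Complex.ofReal_re])).1
    have hi3 : i ≤ 3 :=
      PrimitiveQuadratic.level_two_pow_le_three hprim (MulChar.isQuadratic_iff_sq_eq_one.mpr hquad)
    -- but `L(β, χ̃) ≠ 0` for `χ̃ ≠ 1` mod `2^i`, `i ≤ 3`, and `β ∈ [1 − η, 1]`
    have hβη : 1 - η ≤ β := by
      rw [hlogP] at hβlo
      have h1 : c₃ / (δ₀ * Real.log N) ≤ η := by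
        rw [div_le_iff₀ (by positivity)]
        have := hlogη
        rw [div_le_iff₀ (by positivity)] at this
        nlinarith
      linarith
    exact hηL i hi3 χe hne β hβη (by linarith) (by exact_mod_cast hzero)

/-! ### Two partners `q ≡ 1 (mod 2^s)` -/

/-- Arithmetic of the main term at a `2`-power modulus: for `A ≥ 2`, `s ≥ 1` and `A s < 2^s`,
`(1/2) · 2^{As} / (φ(2^s) log 2^{As}) > 1` (`φ(2^s) = 2^{s−1}`, `log 2 < 1`). [folklore] -/
theorem one_lt_mainTerm_two_pow {A s : ℕ} (hA : 2 ≤ A) (hs : 1 ≤ s) (hAs : (A : ℝ) * s < (2 : ℝ) ^ s) :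
    (1 : ℝ) < (1 / 2 : ℝ) * ((2 ^ (A * s) : ℕ) : ℝ) /
      (Nat.totient (2 ^ s) * Real.log ((2 ^ (A * s) : ℕ) : ℝ)) := by
  have hφ : Nat.totient (2 ^ s) = 2 ^ (s - 1) := by
    rw [Nat.totient_prime_pow Nat.prime_two hs]; simp
  have hs0 : (0 : ℝ) < s := by exact_mod_cast hs
  have hA0 : (0 : ℝ) < A := by exact_mod_cast (show 0 < A by omega)
  have hlog2 : Real.log 2 < 1 := by have := Real.log_two_lt_d9; linarith
  have hlog2pos : 0 < Real.log 2 := Real.log_pos one_lt_two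
  have hcast : ((2 ^ (A * s) : ℕ) : ℝ) = (2 : ℝ) ^ (A * s) := by push_cast; ring
  have hlog : Real.log ((2 ^ (A * s) : ℕ) : ℝ) = (A * s : ℕ) * Real.log 2 := by
    rw [hcast, Real.log_pow]
  rw [hφ, hlog]
  push_cast
  have hden : (0 : ℝ) < (2 : ℝ) ^ (s - 1) * ((A : ℝ) * s * Real.log 2) := by positivity
  rw [lt_div_iff₀ hden, one_mul]
  -- `2^(s-1) · (A s log 2) < 2^(s-1) · A s < 2^(s-1) · 2^s ≤ (1/2) · 2^(A s)`
  have h1 : (2 : ℝ) ^ (s - 1) * ((A : ℝ) * s * Real.log 2) < (2 : ℝ) ^ (s - 1) * (2 : ℝ) ^ s := by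
    refine mul_lt_mul_of_pos_left ?_ (by positivity)
    calc (A : ℝ) * s * Real.log 2 ≤ (A : ℝ) * s * 1 :=
          mul_le_mul_of_nonneg_left hlog2.le (by positivity)
      _ = (A : ℝ) * s := mul_one _
      _ < (2 : ℝ) ^ s := hAs
  have h2 : (2 : ℝ) ^ (s - 1) * (2 : ℝ) ^ s ≤ 1 / 2 * (2 : ℝ) ^ (A * s) := by
    have hpow : (2 : ℝ) ^ (s - 1) * (2 : ℝ) ^ s * 2 = (2 : ℝ) ^ (2 * s) := by
      rw [mul_assoc, ← pow_succ, ← pow_add]; congr 1; omega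
    have hle : (2 : ℝ) ^ (2 * s) ≤ (2 : ℝ) ^ (A * s) :=
      pow_le_pow_right₀ (by norm_num) (Nat.mul_le_mul_right s hA)
    linarith
  linarith

/-- **Two distinct primes `≡ 1 (mod 2^s)` of polynomial height — UNCONDITIONAL.**  There are `A, s₁`
and a threshold function such that for every `s ≥ s₁` there are primes `q₁ ≠ q₂`, both `≡ 1 (mod 2^s)`,
both `≤ 2^{As}`: Gallagher's bound at `N = 2^{As}`, `d = 2^s ≤ N^δ` (`A δ ≥ 1`), where the exceptional
modulus divides no 2-power in range (`exists_goodModulus_not_dvd_two_pow`), gives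
`#{p ≤ N : p ≡ 1 (2^s)} ≥ (1/2)N/(φ(2^s) log N) > 1`. [cite: Gallagher1970, Theorem 7] -/
theorem exists_two_primes_one_mod_two_pow :
    ∃ A s₁ : ℕ, 1 ≤ A ∧ ∀ s : ℕ, s₁ ≤ s → ∃ q₁ q₂ : ℕ, q₁ ≠ q₂ ∧ q₁.Prime ∧ q₂.Prime ∧
      2 ^ s ∣ q₁ - 1 ∧ 2 ^ s ∣ q₂ - 1 ∧ q₁ ≤ 2 ^ (A * s) ∧ q₂ ≤ 2 ^ (A * s) := by
  classical
  obtain ⟨δ, hδ, N₁, hN₁⟩ := exists_goodModulus_not_dvd_two_pow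
  -- `A δ ≥ 1`, `A ≥ 2`
  set A : ℕ := ⌈1 / δ⌉₊ + 2 with hAdef
  have hA2 : 2 ≤ A := by omega
  have hAδ : 1 ≤ (A : ℝ) * δ := by
    have h1 : 1 / δ ≤ ⌈1 / δ⌉₊ := Nat.le_ceil _
    have h2 : (A : ℝ) = ⌈1 / δ⌉₊ + 2 := by rw [hAdef]; push_cast; ring
    rw [h2]
    have : 1 / δ * δ = 1 := by field_simp
    nlinarith
  -- eventual conditions on `s`: `N₁ ≤ 2^(A s)`, `A s < 2^s`, `1 ≤ s`
  have hev : ∀ᶠ s : ℕ in atTop, N₁ ≤ 2 ^ (A * s) ∧ (A : ℝ) * s < (2 : ℝ) ^ s ∧ 1 ≤ s := by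
    refine (?_ : ∀ᶠ s : ℕ in atTop, N₁ ≤ 2 ^ (A * s)).and ((?_ : ∀ᶠ s : ℕ in atTop, _).and
      (eventually_ge_atTop 1))
    · refine (eventually_ge_atTop N₁).mono fun s hs => ?_
      calc N₁ ≤ s := hs
        _ ≤ 2 ^ s := Nat.lt_two_pow_self.le
        _ ≤ 2 ^ (A * s) := Nat.pow_le_pow_right two_pos (Nat.le_mul_of_pos_left s (by omega))
    · have ho : (fun n : ℕ => ((n : ℝ) ^ 1 : ℝ)) =o[atTop] fun n : ℕ => (2 : ℝ) ^ n :=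
        isLittleO_pow_const_const_pow_of_one_lt 1 one_lt_two
      have hA0 : (0 : ℝ) < 1 / (2 * A) := by positivity
      filter_upwards [(Asymptotics.isLittleO_iff.mp ho) hA0] with s hs
      rw [pow_one, Real.norm_of_nonneg (Nat.cast_nonneg _), Real.norm_of_nonneg (by positivity)] at hs
      have hApos : (0 : ℝ) < A := by positivity
      have h2s : (0 : ℝ) < (2 : ℝ) ^ s := by positivity
      calc (A : ℝ) * s ≤ A * (1 / (2 * A) * (2 : ℝ) ^ s) := mul_le_mul_of_nonneg_left hs hApos.le
        _ = (2 : ℝ) ^ s / 2 := by field_simp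
        _ < (2 : ℝ) ^ s := by linarith
  obtain ⟨s₁, hs₁⟩ := eventually_atTop.mp hev
  refine ⟨A, s₁, by omega, fun s hs => ?_⟩
  obtain ⟨hNs, hAs, hs1⟩ := hs₁ s hs
  set N : ℕ := 2 ^ (A * s) with hNdef
  obtain ⟨b, -, hb2pow, hcount⟩ := hN₁ N hNs
  have hNcast : (N : ℝ) = (2 : ℝ) ^ (A * s) := by rw [hNdef]; push_cast; ring
  have hN1 : (1 : ℝ) < N := by
    rw [hNcast]; exact one_lt_pow₀ one_lt_two (Nat.mul_ne_zero (by omega) (by omega))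
  -- `2^s ≤ N^δ`
  have h2sN : ((2 ^ s : ℕ) : ℝ) ≤ (N : ℝ) ^ δ := by
    rw [hNcast, ← Real.rpow_natCast (2 : ℝ) (A * s), ← Real.rpow_mul (by norm_num)]
    push_cast
    rw [← Real.rpow_natCast (2 : ℝ) s]
    refine Real.rpow_le_rpow_of_exponent_le one_le_two ?_
    have hs0 : (0 : ℝ) ≤ s := Nat.cast_nonneg s
    nlinarith
  have hbd : ¬ b ∣ 2 ^ s := hb2pow s h2sN
  have hmain := hcount (2 ^ s) Nat.one_le_two_pow h2sN hbd
  have hgt : (1 : ℝ) < (((Finset.Iic N).filter (fun p => p.Prime ∧ p ≡ 1 [MOD 2 ^ s])).card : ℝ) :=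
    (one_lt_mainTerm_two_pow hA2 hs1 hAs).trans_le hmain
  have hcard : 1 < ((Finset.Iic N).filter (fun p => p.Prime ∧ p ≡ 1 [MOD 2 ^ s])).card := by
    exact_mod_cast hgt
  obtain ⟨q₁, hq₁, q₂, hq₂, hne⟩ := Finset.one_lt_card.mp hcard
  simp only [Finset.mem_filter, Finset.mem_Iic] at hq₁ hq₂
  obtain ⟨hq₁N, hq₁p, hq₁1⟩ := hq₁
  obtain ⟨hq₂N, hq₂p, hq₂1⟩ := hq₂
  exact ⟨q₁, q₂, hne, hq₁p, hq₂p, (Nat.modEq_iff_dvd' hq₁p.one_lt.le).mp hq₁1.symm,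
    (Nat.modEq_iff_dvd' hq₂p.one_lt.le).mp hq₂1.symm, hq₁N, hq₂N⟩

/-! ### The two-prime supply -/

/-- **The two-prime 2-power supply — UNCONDITIONAL.**  There are `A, s₁` such that for every `s ≥ s₁`
there are primes `q`, `ℓ` with `2^s ∣ q − 1`, `2^s q ∣ ℓ − 1` and `ℓ ≤ 2^{As}`.  Proof: take two partners
`q₁ ≠ q₂ ≡ 1 (mod 2^s)`, `q_i ≤ 2^{A₁ s}` (`exists_two_primes_one_mod_two_pow`), and Gallagher's bound at
`N = 2^{A₂ s}` with the moduli `d_i = 2^s q_i ≤ N^δ`; the exceptional modulus `b` divides at most one `d_i`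
(if it divided both it would divide `gcd(d₁, d₂) = 2^s`, excluded by `exists_goodModulus_not_dvd_two_pow`),
and for the other `#{ℓ ≤ N : ℓ ≡ 1 (d_i)} ≥ (1/2)N/(φ(d_i) log N) > 0`. This is the special case of
Linnik's theorem (class `1`, moduli `2^s` and `2^s q`) that avoids the Deuring–Heilbronn phenomenon.
[cite: Gallagher1970, Theorem 7] -/
theorem exists_primes_two_pow_mul_dvd_sub_one :
    ∃ A s₁ : ℕ, ∀ s : ℕ, s₁ ≤ s →
      ∃ q ℓ : ℕ, q.Prime ∧ ℓ.Prime ∧ 2 ^ s ∣ q - 1 ∧ 2 ^ s * q ∣ ℓ - 1 ∧ ℓ ≤ 2 ^ (A * s) := by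
  classical
  obtain ⟨δ, hδ, N₁, hN₁⟩ := exists_goodModulus_not_dvd_two_pow
  obtain ⟨A₁, s₀, hA₁, hpart⟩ := exists_two_primes_one_mod_two_pow
  -- `A₂ δ ≥ A₁ + 1`
  set M : ℕ := ⌈1 / δ⌉₊ + 1 with hMdef
  have hMδ : 1 ≤ (M : ℝ) * δ := by
    have h1 : 1 / δ ≤ ⌈1 / δ⌉₊ := Nat.le_ceil _
    have h2 : (M : ℝ) = ⌈1 / δ⌉₊ + 1 := by rw [hMdef]; push_cast; ring
    rw [h2]
    have : 1 / δ * δ = 1 := by field_simp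
    nlinarith
  set A₂ : ℕ := M * (A₁ + 1) with hA₂def
  have hA₂δ : ((A₁ : ℝ) + 1) ≤ (A₂ : ℝ) * δ := by
    have h2 : (A₂ : ℝ) * δ = ((M : ℝ) * δ) * ((A₁ : ℝ) + 1) := by rw [hA₂def]; push_cast; ring
    rw [h2]
    have hA₁0 : (0 : ℝ) ≤ (A₁ : ℝ) + 1 := by positivity
    nlinarith
  have hA₂1 : 1 ≤ A₂ := by
    have hM1 : 1 ≤ M := by omega
    calc 1 = 1 * 1 := rfl
      _ ≤ M * (A₁ + 1) := Nat.mul_le_mul hM1 (by omega)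
  -- eventual conditions on `s`: `s₀ ≤ s`, `N₁ ≤ 2^(A₂ s)`, `1 ≤ s`
  have hev : ∀ᶠ s : ℕ in atTop, s₀ ≤ s ∧ N₁ ≤ 2 ^ (A₂ * s) ∧ 1 ≤ s := by
    refine (eventually_ge_atTop s₀).and ((?_ : ∀ᶠ s : ℕ in atTop, N₁ ≤ 2 ^ (A₂ * s)).and
      (eventually_ge_atTop 1))
    refine (eventually_ge_atTop N₁).mono fun s hs => ?_
    calc N₁ ≤ s := hs
      _ ≤ 2 ^ s := Nat.lt_two_pow_self.le
      _ ≤ 2 ^ (A₂ * s) := Nat.pow_le_pow_right two_pos (Nat.le_mul_of_pos_left s (by omega))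
  obtain ⟨s₁, hs₁⟩ := eventually_atTop.mp hev
  refine ⟨A₂, s₁, fun s hs => ?_⟩
  obtain ⟨hss₀, hNs, hs1⟩ := hs₁ s hs
  obtain ⟨q₁, q₂, hne, hq₁, hq₂, hd₁, hd₂, hq₁A, hq₂A⟩ := hpart s hss₀
  set N : ℕ := 2 ^ (A₂ * s) with hNdef
  obtain ⟨b, -, hb2pow, hcount⟩ := hN₁ N hNs
  have hNcast : (N : ℝ) = (2 : ℝ) ^ (A₂ * s) := by rw [hNdef]; push_cast; ring
  have hN0 : (0 : ℝ) < N := by rw [hNcast]; positivity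
  have hN1 : (1 : ℝ) < N := by
    rw [hNcast]; exact one_lt_pow₀ one_lt_two (Nat.mul_ne_zero (by omega) (by omega))
  have hL0 : 0 < Real.log N := Real.log_pos hN1
  -- the moduli `2^s q_i ≤ 2^s 2^(A₁ s) = 2^((A₁+1) s) ≤ N^δ`
  have hrange : ∀ q : ℕ, q ≤ 2 ^ (A₁ * s) → ((2 ^ s * q : ℕ) : ℝ) ≤ (N : ℝ) ^ δ := by
    intro q hq
    have h1 : 2 ^ s * q ≤ 2 ^ ((A₁ + 1) * s) := by
      calc 2 ^ s * q ≤ 2 ^ s * 2 ^ (A₁ * s) := Nat.mul_le_mul_left _ hq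
        _ = 2 ^ ((A₁ + 1) * s) := by rw [← pow_add]; congr 1; ring
    have h2 : ((2 ^ s * q : ℕ) : ℝ) ≤ (2 : ℝ) ^ ((A₁ + 1) * s) := by exact_mod_cast h1
    refine h2.trans ?_
    rw [hNcast, ← Real.rpow_natCast (2 : ℝ) (A₂ * s), ← Real.rpow_mul (by norm_num),
      ← Real.rpow_natCast (2 : ℝ) ((A₁ + 1) * s)]
    refine Real.rpow_le_rpow_of_exponent_le one_le_two ?_
    push_cast
    have hs0 : (0 : ℝ) ≤ s := Nat.cast_nonneg s
    nlinarith
  have h2srange : ((2 ^ s : ℕ) : ℝ) ≤ (N : ℝ) ^ δ :=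
    le_trans (by exact_mod_cast Nat.le_mul_of_pos_right (2 ^ s) hq₁.pos) (hrange q₁ hq₁A)
  -- `b` divides at most one of the two moduli
  have hodd : ∀ q : ℕ, q.Prime → 2 ^ s ∣ q - 1 → q ≠ 2 := by
    intro q hq hdq h2
    rw [h2] at hdq
    have := Nat.le_of_dvd (by norm_num) hdq
    have : 2 ≤ 2 ^ s := by
      calc 2 = 2 ^ 1 := (pow_one 2).symm
        _ ≤ 2 ^ s := Nat.pow_le_pow_right two_pos hs1
    omega
  have hgood : ¬ b ∣ 2 ^ s * q₁ ∨ ¬ b ∣ 2 ^ s * q₂ := by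
    by_contra hcon
    push Not at hcon
    obtain ⟨h₁, h₂⟩ := hcon
    have hcop : Nat.Coprime q₁ q₂ := (Nat.coprime_primes hq₁ hq₂).mpr hne
    have hgcd : Nat.gcd (2 ^ s * q₁) (2 ^ s * q₂) = 2 ^ s := by
      rw [Nat.gcd_mul_left, hcop, mul_one]
    have : b ∣ 2 ^ s := hgcd ▸ Nat.dvd_gcd h₁ h₂
    exact hb2pow s h2srange this
  -- the prime `ℓ ≡ 1 (mod 2^s q_i)` for the good `i`
  have hfinish : ∀ q : ℕ, q.Prime → 2 ^ s ∣ q - 1 → q ≤ 2 ^ (A₁ * s) → ¬ b ∣ 2 ^ s * q →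
      ∃ q' ℓ : ℕ, q'.Prime ∧ ℓ.Prime ∧ 2 ^ s ∣ q' - 1 ∧ 2 ^ s * q' ∣ ℓ - 1 ∧ ℓ ≤ 2 ^ (A₂ * s) := by
    intro q hq hdq hqA hbq
    have hd1 : 1 ≤ 2 ^ s * q := Nat.one_le_iff_ne_zero.mpr (Nat.mul_ne_zero (by positivity) hq.ne_zero)
    have hmain := hcount (2 ^ s * q) hd1 (hrange q hqA) hbq
    have hpos : (0 : ℝ) < (1 / 2 : ℝ) * N / (Nat.totient (2 ^ s * q) * Real.log N) := by
      have hφ : (0 : ℝ) < Nat.totient (2 ^ s * q) := by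
        exact_mod_cast Nat.totient_pos.mpr (by omega)
      positivity
    have hcard : 0 < ((Finset.Iic N).filter (fun p => p.Prime ∧ p ≡ 1 [MOD 2 ^ s * q])).card := by
      have := hpos.trans_le hmain
      exact_mod_cast this
    obtain ⟨ℓ, hℓ⟩ := Finset.card_pos.mp hcard
    simp only [Finset.mem_filter, Finset.mem_Iic] at hℓ
    obtain ⟨hℓN, hℓp, hℓ1⟩ := hℓ
    exact ⟨q, ℓ, hq, hℓp, hdq, (Nat.modEq_iff_dvd' hℓp.one_lt.le).mp hℓ1.symm, hℓN⟩
  rcases hgood with h | h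
  · exact hfinish q₁ hq₁ hd₁ hq₁A h
  · exact hfinish q₂ hq₂ hd₂ hq₂A h

end PrimesInAPGallagher

end Literature.NumberTheory.Sieve
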